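import Summits.HodgeConjecture.HodgeConjecture.Theorems.Ring2HypothesesDescentMotivatedLefschetzComponents
import Summits.HodgeConjecture.HodgeConjecture.Theorems.Ring2AbelianAllAndreFibreClassPrimitiveParts
import Literature.AlgebraicTopology.SingularHomology.GysinTransposition
import HarnessLib

/-!
# Ring 2 hypotheses, descent face — André's `*_θ` is self-adjoint for the cup product; primitive
# orthogonality; the cup pairing of a correspondence action (tools for Prop. 2.2)

research route conditional on HC_CM; not a corollary; Q11.4-sentence-2 already refuted in dim ≥ 3.
Cell `pub-hodge-ring2` (Hodge ladder STAGE 3), seat `ring2-b05` (binder row b05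
`Ring2.Hypotheses.MotivatedImpliesAlgebraicAV`), gen 36. `HC_CM` (`Theses.RankFourFaces.CMAbelianHodge`) does
not occur in this file; nothing here proves a case of the Hodge conjecture; the row b05 stays OPEN.

Purpose. André 1996, Prop. 2.2 (*Pour une théorie inconditionnelle des motifs*, Publ. Math. IHÉS 83, p. 16: the
Lefschetz involution `*_L` of a polarised `X` is a MOTIVATED correspondence, hence Cor. 1 «`A_mot(X)` est stable
sous `*`» and Cor. 2, the Lefschetz decomposition inside `A_mot(X)`) is proved in print through the element
`*_{X²}(L^{d-i}) ∈ A_mot(X × X)` and the remark «`*` est son propre transposé». This file supplies the three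
linear-algebra tools of that computation on the real carriers `H•(X(ℂ); ℂ)`:

* §1 `cupProduct_lefschetzPowTo_eq_zero_of_ne` — primitive classes of DIFFERENT degrees are cup-orthogonal after
  any power of `L` landing in the top degree (Voisin I Lemma 6.29);
* §2 `cupProduct_lefschetzInvolution_comm` — **«`*` est son propre transposé»**: `(*_θ c) ∪ v = c ∪ (*_θ v)` in
  `H^{2D}(Z(ℂ); ℂ)` for `c`, `v` of the same degree (André's sign-free `*_θ`; term by term on the two Lefschetz
  decompositions, `*_θ (Lᵏ p) = Lˢ p` with `i + k + s = D`);
* §3 `map_lift_cross` — `Δ^*(fst^* a ∪ snd^* b) = a ∪ b`; `cupPairing_corrClassAction` — the cup pairing of a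
  correspondence action: `⟨u^*(x), y⟩_W = (-1)^{deg x · deg y} ⟨u ∪ (fst^* y ∪ snd^* x), [W ⊗ X]⟩` (projection
  formula / transposition of the Gysin map, Fulton App. B (5)–(6), the tree's `cupPairing_gysinMap`);
* §4 `exists_eq_smul_of_ker_le` — two linear forms with nested kernels are proportional (Mathlib's
  `mem_span_of_iInf_ker_le_ker`, one-element family).

No definition, no named fact, no sorry. References: Andre1996Motifs (§1.1 p. 10, Prop. 2.2 p. 16), VoisinHodgeI2002
(§6.2.3 Cor. 6.26, Lemma 6.29), VoisinHodgeII2003 (proof of Thm. 10.17 (10.7)), FultonYoungTableaux1997 (App. B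
(5)–(6)), HatcherAT2002 (§3.2 Prop. 3.10, Thm. 3.11, §3.3 p. 249).
-/

noncomputable section

-- every declaration of this problem lives in `Summit.HodgeConjecture.HodgeConjecture.…` (summit = sub-problem)
set_option linter.dupNamespace false

open CategoryTheory AlgebraicGeometry MonoidalCategory CartesianMonoidalCategory
open Literature.AlgebraicTopology.SingularHomology Literature.Geometry.Kaehler
open Literature.AlgebraicGeometry Literature.AlgebraicGeometry.Motives
  Literature.AlgebraicGeometry.HodgeTheory

namespace Summit.HodgeConjecture.HodgeConjecture.Theorems

universe u v

/-! ## §1 Primitive classes of different degrees are cup-orthogonal -/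

/-- **Orthogonality of the Lefschetz decomposition** (Voisin I Lemma 6.29 / proof of Thm. 6.32): for `p ∈ Pⁱ`,
`q ∈ P^{i'}` primitive (for `κ`, dimension `n`) with `i ≠ i'` and `i + 2e + i' = 2n`, `(Lᵉ p) ∪ q = 0` in
`H^{2n}(Y; R)` — moving `Lᵉ` onto the factor of larger primitive degree kills it past the top of its string.
[cite: VoisinHodgeI2002, §6.2.3 Lemma 6.29] [cite: HatcherAT2002, §3.2 Thm. 3.11] -/
theorem cupProduct_lefschetzPowTo_eq_zero_of_ne {Y : Type u} [TopologicalSpace Y] {R : Type v} [CommRing R]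
    {κ : singularCohomology R R Y 2} {n i i' e m : ℕ} {p : singularCohomology R R Y i}
    {q : singularCohomology R R Y i'} (hp : p ∈ primitiveClasses κ n i) (hq : q ∈ primitiveClasses κ n i')
    (hne : i ≠ i') (hm : i + 2 * e = m) (h : m + i' = 2 * n) :
    cupProduct h (lefschetzPowTo κ e i m hm p) q = 0 := by
  rcases Nat.lt_or_gt_of_ne hne with hlt | hgt
  · -- `i < i'`: `Lᵉ q = 0`
    rw [cupProduct_lefschetzPowTo_left κ e hm h (rfl : i + i' = i + i') (by omega) p q,
      ← cupProduct_lefschetzPowTo_right κ e (rfl : i' + 2 * e = i' + 2 * e) (by omega) (rfl : i + i' = i + i')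
        (by omega) p q,
      lefschetzPowTo_eq_zero_of_mem_primitiveClasses hq _ (by omega), map_zero]
  · -- `i' < i`: `Lᵉ p = 0`
    rw [lefschetzPowTo_eq_zero_of_mem_primitiveClasses hp _ (by omega), map_zero, LinearMap.zero_apply]

/-- The same with the primitive class of larger… either degree on the left: `q ∪ (Lᵉ p) = 0` for `p ∈ Pⁱ`,
`q ∈ P^{i'}`, `i ≠ i'`, `i' + i + 2e = 2n`. [cite: VoisinHodgeI2002, §6.2.3 Lemma 6.29] -/
theorem cupProduct_lefschetzPowTo_eq_zero_of_ne' {Y : Type u} [TopologicalSpace Y] {R : Type v} [CommRing R]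
    {κ : singularCohomology R R Y 2} {n i i' e m : ℕ} {p : singularCohomology R R Y i}
    {q : singularCohomology R R Y i'} (hp : p ∈ primitiveClasses κ n i) (hq : q ∈ primitiveClasses κ n i')
    (hne : i ≠ i') (hm : i + 2 * e = m) (h : i' + m = 2 * n) :
    cupProduct h q (lefschetzPowTo κ e i m hm p) = 0 := by
  rw [cupProduct_lefschetzPowTo_right κ e hm h (rfl : i' + i = i' + i) (by omega) q p,
    ← cupProduct_lefschetzPowTo_left κ e (rfl : i' + 2 * e = i' + 2 * e) (by omega) (rfl : i' + i = i' + i)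
      (by omega) q p]
  exact cupProduct_lefschetzPowTo_eq_zero_of_ne hq hp hne.symm rfl (by omega)

/-! ## §2 `*_θ` is self-adjoint for the cup product -/

variable {D : ℕ} {Z : SchemeOver ℂ} {θ : complexBetti Z 2}

/-- One pair of Lefschetz components: for `p ∈ Hⁱ`, `q ∈ H^{i'}` (any classes), `i + 2k = a = i' + 2k'` and
`i + k ≤ D`, `i' + k' ≤ D`: `(*_θ Lᵏ p) ∪ (L^{k'} q) = (Lᵏ p) ∪ (*_θ L^{k'} q)` — both are `p ∪ Lᵉ q` with the
same `e` (`*_θ (Lᵏ p) = Lˢ p`, `i + k + s = D`). [cite: Andre1996Motifs, §1.1 (p. 10)] -/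
theorem cupProduct_lefschetzInvolution_lefschetzPowTo_comm (hθ : HasHardLefschetzProperty θ D) {a b i i' k k' : ℕ}
    (hab : a + b = 2 * D) (hba : b + a = 2 * D) (hk : i + 2 * k = a) (hk' : i' + 2 * k' = a) (hi : i + k ≤ D)
    (hi' : i' + k' ≤ D) (p : complexBetti Z i) (q : complexBetti Z i') :
    cupProduct hba (lefschetzInvolution hθ hab (lefschetzPowTo θ k i a hk p)) (lefschetzPowTo θ k' i' a hk' q) =
      cupProduct hab (lefschetzPowTo θ k i a hk p) (lefschetzInvolution hθ hab (lefschetzPowTo θ k' i' a hk' q)) := by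
  obtain ⟨s, hs⟩ : ∃ s, i + k + s = D := ⟨D - (i + k), by omega⟩
  obtain ⟨s', hs'⟩ : ∃ s', i' + k' + s' = D := ⟨D - (i' + k'), by omega⟩
  rw [lefschetzInvolution_lefschetzPowTo_eq hθ hs hk hab (show i + 2 * s = b by omega) p,
    lefschetzInvolution_lefschetzPowTo_eq hθ hs' hk' hab (show i' + 2 * s' = b by omega) q,
    cupProduct_lefschetzPowTo_lefschetzPowTo θ s k' (show i + 2 * s = b by omega) hk' hba
      (show i' + 2 * (s + k') = i' + 2 * (s + k') from rfl) (by omega) p q,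
    cupProduct_lefschetzPowTo_lefschetzPowTo θ k s' hk (show i' + 2 * s' = b by omega) hab
      (show i' + 2 * (k + s') = i' + 2 * (s + k') by omega) (by omega) p q,
    lefschetzPowTo_congr_exponent θ (show s + k' = k + s' by omega) _ _ q]

/-- **«`*` est son propre transposé»** (André 1996, proof of Prop. 2.2): for `Z` smooth projective of dimension `D`,
`θ ∈ H²(Z(ℂ); ℂ)` with the hard Lefschetz property and `c`, `v ∈ Hᵃ(Z(ℂ); ℂ)` (`a + b = 2D`), André's sign-free
involution satisfies `(*_θ c) ∪ v = c ∪ (*_θ v)` in `H^{2D}(Z(ℂ); ℂ)`. Proof: expand both classes in Lefschetz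
components (`exists_sum_lefschetzPowTo_eq`) and use `cupProduct_lefschetzInvolution_lefschetzPowTo_comm` term by
term. [cite: Andre1996Motifs, Prop. 2.2 (p. 16) and §1.1 (p. 10)] [cite: VoisinHodgeI2002, §6.2.3 Cor. 6.26] -/
theorem cupProduct_lefschetzInvolution_comm (hZ : IsSmoothProjective D Z) (hθ : HasHardLefschetzProperty θ D)
    {a b : ℕ} (hab : a + b = 2 * D) (hba : b + a = 2 * D) (c v : complexBetti Z a) :
    cupProduct hba (lefschetzInvolution hθ hab c) v = cupProduct hab c (lefschetzInvolution hθ hab v) := by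
  classical
  obtain ⟨s, p, -, hs, rfl⟩ := exists_sum_lefschetzPowTo_eq hZ hθ c
  obtain ⟨s', q, -, hs', rfl⟩ := exists_sum_lefschetzPowTo_eq hZ hθ v
  simp only [map_sum, LinearMap.sum_apply]
  refine Finset.sum_congr rfl fun ik' hik' ↦ Finset.sum_congr rfl fun ik hik ↦ ?_
  exact cupProduct_lefschetzInvolution_lefschetzPowTo_comm hθ hab hba ik.2 ik'.2 (hs ik hik) (hs' ik' hik') _ _

/-! ## §3 The diagonal and the cup pairing of a correspondence action -/

variable {n m : ℕ} {X W : SchemeOver ℂ}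

/-- **`Δ^*(fst^* a ∪ snd^* b) = a ∪ b`** for the diagonal `Δ = lift (𝟙 X) (𝟙 X) : X ⟶ X ⊗ X` (`f^*` is
multiplicative, Hatcher Prop. 3.10, and `Δ ≫ fst = 𝟙 = Δ ≫ snd`). [cite: HatcherAT2002, §3.2 Prop. 3.10] -/
theorem map_lift_cross {i j k : ℕ} (h : i + j = k) (a : complexBetti X i) (b : complexBetti X j) :
    complexBetti.map (lift (𝟙 X) (𝟙 X)) k
        (cupProduct h (complexBetti.map (fst X X) i a) (complexBetti.map (snd X X) j b)) = cupProduct h a b := by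
  rw [complexBetti.map, cupProduct_map]
  change cupProduct h ((complexBetti.map (fst X X) i ≫ complexBetti.map (lift (𝟙 X) (𝟙 X)) i) a)
    ((complexBetti.map (snd X X) j ≫ complexBetti.map (lift (𝟙 X) (𝟙 X)) j) b) = _
  rw [← complexBetti.map_comp, ← complexBetti.map_comp, lift_fst, lift_snd, complexBetti.map_id,
    complexBetti.map_id]
  rfl

/-- **The cup pairing of a correspondence action.** For `W`, `X` of dimensions `m`, `n`, orientations `μ` of
`(W ⊗ X)(ℂ)` and `ν` of `W(ℂ)` with `ν` satisfying Poincaré duality, `u ∈ H^{2e}((W ⊗ X)(ℂ))`, `x ∈ Hᵃ(X(ℂ))`,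
`y ∈ H^q(W(ℂ))`: `⟨u^*(x), y⟩_ν = (-1)^{a q} ⟨u ∪ (fst^* y ∪ snd^* x), [W ⊗ X]_μ⟩` (the cross product in any
spelling `s` of its degree `q + a`), where
`u^*(x) = fst_*(snd^* x ∪ u)` (`HodgeTheory.corrClassAction`): the Gysin map is the transpose of `fst^*`
(`cupPairing_gysinMap`, Fulton App. B (5)–(6)) and the cup product is associative and graded commutative (`u` has
even degree). [cite: FultonYoungTableaux1997, Appendix B §B.1 (5)–(6)] [cite: VoisinHodgeII2003, proof of Thm. 10.17 (10.7)]
[cite: HatcherAT2002, §3.2 Thm. 3.11 and §3.3 p. 249] -/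
theorem cupPairing_corrClassAction (μ : HomologicalOrientation ℂ (ComplexPoints (W ⊗ X)) (2 * (m + n)))
    (ν : HomologicalOrientation ℂ (ComplexPoints W) (2 * m)) (hν : ν.HasPoincareDuality) {e a b q : ℕ}
    (hab : a + 2 * e = b + 2 * n) (hq : b + q = 2 * m) {s : ℕ} (hqa : q + a = s) (h : 2 * e + s = 2 * (m + n))
    (u : complexBetti (W ⊗ X) (2 * e)) (x : complexBetti X a) (y : complexBetti W q) :
    cupPairing ν hq (corrClassAction μ ν hab hq u x) y =
      ((-1 : ℂ) ^ (a * q)) • cupPairing μ h u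
        (cupProduct hqa (complexBetti.map (fst W X) q y) (complexBetti.map (snd W X) a x)) := by
  rw [corrClassAction_apply, cupPairing_gysinMap hν, cupPairing_apply, cupPairing_apply]
  change kroneckerPairing ℂ ℂ _ _ (cupProduct _ (cupProduct rfl (complexBetti.map (snd W X) a x) u)
    (complexBetti.map (fst W X) q y)) _ = _
  rw [cupProduct_gradedComm_holds ℂ (ComplexPoints (W ⊗ X)) (rfl : a + 2 * e = a + 2 * e)
      (show 2 * e + a = a + 2 * e by omega) _ u,
    show ((-1 : ℂ) ^ (a * (2 * e))) = 1 by
      rw [show a * (2 * e) = 2 * (a * e) by ring, pow_mul, neg_one_sq, one_pow], one_smul,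
    cupProduct_assoc (show 2 * e + a = a + 2 * e by omega) (show a + q = s by omega)
      (show a + 2 * e + q = 2 * (m + n) by omega) h u _ _,
    cupProduct_gradedComm_holds ℂ (ComplexPoints (W ⊗ X)) (show a + q = s by omega) hqa _ _,
    LinearMap.map_smul, map_smul, LinearMap.smul_apply, smul_eq_mul]

/-! ## §4 Linear forms with nested kernels are proportional -/

/-- Two linear forms `K`, `L` on a vector space with `ker L ≤ ker K` are proportional: `K = c • L`
(Mathlib's `mem_span_of_iInf_ker_le_ker` for the one-element family). [folklore] -/
theorem exists_eq_smul_of_ker_le {𝕜 E : Type*} [Field 𝕜] [AddCommGroup E] [Module 𝕜 E] {K L : E →ₗ[𝕜] 𝕜}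
    (h : LinearMap.ker L ≤ LinearMap.ker K) : ∃ c : 𝕜, K = c • L := by
  have hK : K ∈ Submodule.span 𝕜 (Set.range fun _ : Unit ↦ L) :=
    mem_span_of_iInf_ker_le_ker (by simpa only [iInf_const] using h)
  rw [Set.range_const, Submodule.mem_span_singleton] at hK
  obtain ⟨c, hc⟩ := hK
  exact ⟨c, hc.symm⟩

end Summit.HodgeConjecture.HodgeConjecture.Theorems

end
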